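import Summits.Ventures.GridStability.Lyapunov.WSCC9LossySlab
import Literature.MathematicalPhysics.PowerSystems.LuriePostnikovSlabInstanceForms
import Literature.Computation.Certificates.PosSemidefDecide

/-!
# GridStability/Lyapunov/WSCC9LossySlabCenter — the ONE-FACT centre form of the #35 lane-V LMI
# (lead RULING #35 LANE V — CENTRE FORM ALLOWED, 2026-08-27T08:47:38Z)

Venture GRIDFUSION, #35 «G2.c-WSCC9-LOSSY-SLAB», lane V (lyap-1: `WSCC9LossySlabData/Psd/Cast`, sos-2
Λ `2541e15e`, vertex pack `0d3f30ad`); drafted by gridfusion-lit-6 (g6) as a drop-in for lyap-1 (custody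
`Lyapunov/` = lyap-1; file it or fold it into the assembly). The receptacle is lit-6's
`Literature/MathematicalPhysics/PowerSystems/LuriePostnikovSlabInstanceForms.lean` (p514997)
`SlabCertificate.ofCenter` / `neg_slabMatrix_posSemidef_of_center`: with the weight box written in
centre–radius form `|w_j − c_j| ≤ r_j` (`c = (lo + hi)/2`, `r = (hi − lo)/2`, the SAME tree-7-digit box of
`WSCC9LossySlabCast.hw`), the single PSD fact
`H := N₀ + Σ_j c_j N_j − Σ_j r_j·rowAbsDiag(N_j) ⪰ 0` (14 × 14, the SAME literals `N0`, `Nmat` of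
`WSCC9LossySlabData`) replaces the 64 vertex facts. lit-6's exact pre-check
(`lit/lit-6-probes/center_form_check.json` 6a0b90bcf4074034): `H ≻ 0`, min LDLᵀ pivot `2.2·10⁻⁷`.

WHAT IS HERE (all kernel): `ctrQ`, `radQ`, `Hc` (computed in the kernel from `N0`, `Nmat`), `Hc_psd :
PSD.LDLCert Hc` (ONE `decide`, no producer certificate), `posSemidef_Hc` (over `ℝ`), the `ℚ`-level
identity `negSlabQ_center_eq : −(𝓛₀ + 𝓛_lin(Σ c_j B_j)) − Σ r_j·rowAbsDiag(𝓛_lin(B_j)) = Hc` (reindexed;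
`decide`), and `hw_center : |w_j − c_j| ≤ r_j`. Then the `ℝ` side via lyap-1's public cast identities
`slab0_eq` / `slabLin_eq` / `Bj_eq` (`WSCC9LossySlab.lean`): `neg_slab_center_eq`, `h0_center`, and the SECOND
LINEAGE `certC := SlabCertificate.ofCenter hB hw_center … h0_center` with `certC.V = cert.V` (`rfl`) — the same
Lyapunov function certified from ONE PSD fact instead of 64 (rider evidence per the lead's ruling: the vertex
assembly `cert` is the one of record).

THREE COLUMNS. CERTIFIED (kernel): `Hc ⪰ 0` and the identities, about the MODEL `WSCC9.lurieSystem`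
(directed Lur'e form of «WSCC9-postB-SPdamp-h12», transfer conductances KEPT, damping DECLARED
`D/M = 1/10, 1/5, 3/10`). VALIDATED: sos-2's SDP; lit-6's Python pre-check. MODELLED: as
`Models/WSCC9.lean` / `ClassicalSwingLurie.lean`. No sentence of this file says a grid is stable.
-/

noncomputable section

namespace Summit.Ventures.GridStability.Lyapunov.WSCC9LossySlab

open Matrix Literature.Computation.Certificates
open Literature.MathematicalPhysics.PowerSystems
open Literature.MathematicalPhysics.PowerSystems.LyapunovFunctionFamily
open Summit.Ventures.GridStability.Models
open Summit.Ventures.GridStability.Lyapunov.LurieObstruction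

/-- Centre of the weight box: `c_j = (lo_j + hi_j)/2`. -/
def ctrQ (j : Fin 6) : ℚ := (loQ j + hiQ j) / 2

/-- Radius of the weight box: `r_j = (hi_j − lo_j)/2`. -/
def radQ (j : Fin 6) : ℚ := (hiQ j - loQ j) / 2

/-- Centre (real). -/
def ctr (j : Fin 6) : ℝ := (ctrQ j : ℝ)

/-- Radius (real). -/
def rad (j : Fin 6) : ℝ := (radQ j : ℝ)

/-- **The ONE matrix** `H = N₀ + Σ_j c_j N_j − Σ_j r_j·rowAbsDiag(N_j)` (14 × 14 over `ℚ`, computed in the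
kernel from lane V's literals). -/
def Hc : Matrix (Fin 14) (Fin 14) ℚ :=
  N0 + ∑ j, ctrQ j • Nmat j - ∑ j, radQ j • rowAbsDiag (Nmat j)

set_option maxHeartbeats 4000000 in
/-- **`H ⪰ 0`** by ONE in-kernel exact `LDLᵀ` (no producer certificate). -/
theorem Hc_psd : PSD.LDLCert Hc := by
  decide +kernel

/-- `H ⪰ 0` over `ℝ`. -/
theorem posSemidef_Hc : (Hc.map (Rat.cast : ℚ → ℝ)).PosSemidef := Hc_psd.posSemidef

set_option maxHeartbeats 4000000 in
/-- **The `ℚ`-level centre identity** (the `h₀` matrix of lit-6's `neg_slabMatrix_posSemidef_of_center`,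
over `ℚ`, on the receptacle's index type): `−(𝓛₀ + 𝓛_lin(Σ_j c_j • B_j)) − Σ_j r_j • rowAbsDiag(𝓛_lin(B_j))
= H` reindexed by `e2`. -/
theorem negSlabQ_center_eq :
    -(slab0Q + slabLinQ (∑ j, ctrQ j • BjQ j)) - ∑ j, radQ j • rowAbsDiag (slabLinQ (BjQ j))
      = Hc.submatrix e2 e2 := by
  decide +kernel

/-- **Centre–radius membership of the true weights**: `|w_j − c_j| ≤ r_j` (from `hw`). -/
theorem hw_center : ∀ j, |w j - ctr j| ≤ rad j := by
  intro j
  obtain ⟨h1, h2⟩ := hw j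
  simp only [ctr, rad, ctrQ, radQ]
  push_cast
  rw [abs_sub_le_iff]
  constructor <;> linarith


/-! ### The `ℝ` side: the receptacle's centre matrix IS `Hc ↦ ℝ` (reindexed); the SECOND LINEAGE `certC` -/

/-- `(Σ_j M_j) ↦ ℝ = Σ_j (M_j ↦ ℝ)` (plumbing). -/
private theorem map_sum'' {m n : Type*} {J : Type*} (s : Finset J) (M : J → Matrix m n ℚ) :
    (∑ j ∈ s, M j).map (Rat.cast : ℚ → ℝ) = ∑ j ∈ s, (M j).map (Rat.cast : ℚ → ℝ) := by
  ext i k; simp [Matrix.sum_apply]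

/-- `(M + N) ↦ ℝ`, `(M − N) ↦ ℝ`, `(−M) ↦ ℝ` (plumbing). -/
private theorem map_add'' {m n : Type*} (M N : Matrix m n ℚ) :
    (M + N).map (Rat.cast : ℚ → ℝ) = M.map (Rat.cast : ℚ → ℝ) + N.map (Rat.cast : ℚ → ℝ) := by
  ext i k; simp
/-- `(M − N) ↦ ℝ` (plumbing). -/
private theorem map_sub'' {m n : Type*} (M N : Matrix m n ℚ) :
    (M - N).map (Rat.cast : ℚ → ℝ) = M.map (Rat.cast : ℚ → ℝ) - N.map (Rat.cast : ℚ → ℝ) := by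
  ext i k; simp
/-- `(−M) ↦ ℝ` (plumbing). -/
private theorem map_neg'' {m n : Type*} (M : Matrix m n ℚ) :
    (-M).map (Rat.cast : ℚ → ℝ) = -M.map (Rat.cast : ℚ → ℝ) := by
  ext i k; simp

/-- `(q • M) ↦ ℝ = q • (M ↦ ℝ)` (plumbing). -/
private theorem map_smul'' {m n : Type*} (q : ℚ) (M : Matrix m n ℚ) :
    (q • M).map (Rat.cast : ℚ → ℝ) = ((q : ℚ) : ℝ) • M.map (Rat.cast : ℚ → ℝ) := by
  ext i k; simp

/-- The receptacle's centre input is the cast of the `ℚ` centre input. -/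
theorem centerInput_eq :
    (0 + ∑ j, ctr j • Bj j) = (∑ j, ctrQ j • BjQ j).map (Rat.cast : ℚ → ℝ) := by
  rw [zero_add, map_sum'']
  refine Finset.sum_congr rfl fun j _ => ?_
  rw [map_smul'', Bj_eq, ctr]

/-- The radius terms are casts: `r_j • rowAbsDiag(𝓛_lin(B_j)) = (r_j • rowAbsDiag(slabLinQ B_j)) ↦ ℝ`. -/
theorem radiusTerm_eq (j : Fin 6) :
    rad j • rowAbsDiag (slabMatrixLin WSCC9.lurieSystem.C P lam (Bj j))
      = (radQ j • rowAbsDiag (slabLinQ (BjQ j))).map (Rat.cast : ℚ → ℝ) := by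
  rw [rad, Bj_eq, slabLin_eq, ← rowAbsDiag_map_ratCast, map_smul'']

/-- **The receptacle's centre matrix IS `Hc ↦ ℝ` (reindexed).** -/
theorem neg_slab_center_eq :
    -(slabMatrix₀ WSCC9.lurieSystem.A WSCC9.lurieSystem.C P (etaQ : ℝ) lam τ a b
        + slabMatrixLin WSCC9.lurieSystem.C P lam (0 + ∑ j, ctr j • Bj j))
      - ∑ j, rad j • rowAbsDiag (slabMatrixLin WSCC9.lurieSystem.C P lam (Bj j))
      = (Hc.map (Rat.cast : ℚ → ℝ)).submatrix e2 e2 := by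
  rw [centerInput_eq, slabLin_eq, slab0_eq]
  simp_rw [radiusTerm_eq]
  rw [← map_sum'', ← map_add'', ← map_neg'', ← map_sub'', negSlabQ_center_eq]
  rfl

/-- **`h₀`**: the receptacle's centre matrix minus the radius terms is `⪰ 0` — ONE kernel fact. -/
theorem h0_center :
    (-(slabMatrix₀ WSCC9.lurieSystem.A WSCC9.lurieSystem.C P (etaQ : ℝ) lam τ a b
        + slabMatrixLin WSCC9.lurieSystem.C P lam (0 + ∑ j, ctr j • Bj j))
      - ∑ j, rad j • rowAbsDiag (slabMatrixLin WSCC9.lurieSystem.C P lam (Bj j))).PosSemidef := by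
  rw [neg_slab_center_eq]
  exact (Matrix.posSemidef_submatrix_equiv e2).2 posSemidef_Hc

/-- **THE SAME CERTIFICATE, SECOND KERNEL LINEAGE**: `SlabCertificate WSCC9.lurieSystem` built by lit-6's
`SlabCertificate.ofCenter` from the centre–radius box membership `hw_center` and the ONE fact
`h0_center` (instead of the 64 vertex facts `hv`). All data fields equal `cert`'s. MODEL:
`WSCC9.lurieSystem`; no sentence says a grid is stable. [cite: BentalElghaouiNemirovski2009, §9.1.1
Thm 9.1.2 (a), (c); Pai1981, §2.16 Theorem [18] eqs. (2.63)–(2.64); VuTuritsyn2017, §4.2 Lemma 1] -/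
def certC : SlabCertificate WSCC9.lurieSystem :=
  SlabCertificate.ofCenter WSCC9.lurieSystem (c := ctr) (r := rad) hB hw_center P (epsQ : ℝ) (etaQ : ℝ)
    τ lam a b P_symm
    (by exact_mod_cast epsQ_pos) (by exact_mod_cast etaQ_pos) P_ge
    (fun k => by unfold τ tauK; exact_mod_cast tauQ_nonneg _)
    (fun k => by unfold lam lamK; exact_mod_cast lamQ_nonneg _)
    (fun k hk => by
      unfold a aK
      have hk' : 0 < lamQ (eκ k) := by unfold lam lamK at hk; exact_mod_cast hk
      exact_mod_cast aQ_nonneg_of_lamQ_pos _ hk')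
    h0_center

/-- **The two lineages certify the same Lyapunov function**: `certC.V = cert.V` (same `P`, `λ`, `δ*`). -/
theorem certC_V_eq : certC.V = cert.V := rfl

/-- … and the same sector data: `certC.a = cert.a`, `certC.b = cert.b`, `certC.ε = cert.ε`. -/
theorem certC_data_eq : certC.a = cert.a ∧ certC.b = cert.b ∧ certC.ε = cert.ε ∧ certC.P = cert.P :=
  ⟨rfl, rfl, rfl, rfl⟩

end Summit.Ventures.GridStability.Lyapunov.WSCC9LossySlab

end
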